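import Summits.BirchSwinnertonDyer.Rank1Residual.GaloisImage.KolyvaginInjectivityAllDepths
import HarnessLib

/-!
# Route `KimAtThreeKolyvagin` (rung W2), crux `StubAtEmptyLevelThree` (item 19561): the PUSH-FORWARD of a
# Kolyvagin system along the multi-step reduction `E[3^{k̃+1}] ↠ E[3^{k+1}]` (input (L-b) of
# `KimAtThreeStubLiftability`)

Cell `bsd-addord`, seat `bsd-addord-w2-c2` (gen 3). TOOL FILE: theorems only, no definition, no named fact,
no `sorry`; closes nothing; books nothing. HONEST FRAMING: BSD is not proved by any of this; item 19561 stays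
OPEN. Cell n1011's injectivity dévissage (`KolyvaginInjectivityAllDepths`, seat p11) pushes Kolyvagin systems
forward along the ONE-STEP reduction `x ↦ 3x`; the "stub from liftability" road (Mazur–Rubin Thm. 4.4.3 at
the vertex `∅`) needs the reduction from the lift level `k̃ = 2k+1` down to `k`, i.e. along
`red : E[3^{k̃}·3] → E[3^k·3]`, `x ↦ 3^{k̃−k} x`, for ANY `k ≤ k̃`. This file supplies it, assembling
n1011's `KSDevissage.isKolyvaginSystem_map` exactly as p11's `apply_eq_zero_of_apply_eq_zero_succ` does,
with the gap `k̃ − k` arbitrary: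

* `red_surjective_of_le` — `red` is onto (divisibility of `E(ℚ̄)`);
* `exists_bases_red_of_le` — a `ℤ/3^{k̃+1}`-basis of `E[3^{k̃}·3]` maps under `red` to a `ℤ/3^{k+1}`-basis of
  `E[3^k·3]` (the basis hypothesis of n1011-p15's `singularMap_localMap_eq_fs_of_hasCanonicalComparison`);
* `isKolyvaginSystem_map_red_of_le` — for data `D̃` on `E[3^{k̃}·3]` and `D` on `E[3^k·3]` with the SAME primes
  inside Sakamoto's class of `τ` at level `3^{k̃+1}` and outside `S ⊇ ∞ ∪ {3} ∪ {bad}`, cyclotomic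
  transverse conditions and THE canonical comparison maps for one `η`: `d ↦ red_*(κ_d)` is a Kolyvagin system
  for `(D, 𝓕_can^{(k)})` whenever `κ` is one for `(D̃, 𝓕_can^{(k̃)})`.

References: [MazurRubin2004] Thm. 4.4.3, Prop. 5.2.9; [Sakamoto2024] Def. 3.5, Def. 4.1, Thm. 4.4 (1);
[Rubin2011] Def. 2.2.1, §3.1; [SilvermanAEC2009] Cor. III.6.4 (b).
-/

-- the Theorems namespace of a single-conjunct summit repeats the summit name by design (D-0017)
set_option linter.dupNamespace false

noncomputable section

open scoped Classical NumberField ContRepresentation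
open Field NumberField IsDedekindDomain Module WeierstrassCurve Literature.NumberTheory.EllipticCurves
  Literature.NumberTheory.GaloisRepresentations Literature.NumberTheory.GaloisRepresentations.DiscreteGaloisModule
  Literature.NumberTheory.GaloisCohomology Literature.NumberTheory.GaloisCohomology.KolyvaginDatum
  Summit.BirchSwinnertonDyer.Rank1Residual.GaloisImage
  Summit.BirchSwinnertonDyer.Rank1Residual.GaloisImage.KSDevissage

namespace Summit.BirchSwinnertonDyer.BirchSwinnertonDyer.Theorems.KimAtThreeStubOfLiftable

variable (W : WeierstrassCurve ℚ) {k kt : ℕ} (hkk : k ≤ kt)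
  (red : (W.torsionGaloisModule (((3 : ℕ) : ℤ) ^ kt * ((3 : ℕ) : ℤ))).toContRepresentation →ⁱL
    (W.torsionGaloisModule (((3 : ℕ) : ℤ) ^ k * ((3 : ℕ) : ℤ))).toContRepresentation)
  (hred : ∀ x : geomTorsion W (((3 : ℕ) : ℤ) ^ kt * ((3 : ℕ) : ℤ)),
    ((red x : geomTorsion W (((3 : ℕ) : ℤ) ^ k * ((3 : ℕ) : ℤ))) : geomPoints W) =
      (((3 : ℕ) : ℤ) ^ (kt - k)) • (x : geomPoints W))

include hkk hred in
/-- **The multi-step reduction is onto** (`E(ℚ̄)` is divisible: every `Q ∈ E[3^{k+1}]` is `3^{k̃−k} P`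
with `P ∈ E[3^{k̃+1}]`). [cite: SilvermanAEC2009, Cor. III.6.4 (b)] -/
theorem red_surjective_of_le : Function.Surjective red := by
  intro Q
  have h3 : (((3 : ℕ) : ℤ) ^ (kt - k)) ≠ 0 := pow_ne_zero _ (by norm_num)
  obtain ⟨P, hP⟩ := W.zsmul_geomPoints_surjective_of_charZero h3 (Q : geomPoints W)
  have hP' : (((3 : ℕ) : ℤ) ^ (kt - k)) • P = (Q : geomPoints W) := hP
  have hPmem : P ∈ geomTorsion W (((3 : ℕ) : ℤ) ^ kt * ((3 : ℕ) : ℤ)) := by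
    rw [mem_geomTorsion_iff]
    have hsplit : ((3 : ℕ) : ℤ) ^ kt * ((3 : ℕ) : ℤ) = (((3 : ℕ) : ℤ) ^ k * ((3 : ℕ) : ℤ)) * ((3 : ℕ) : ℤ) ^ (kt - k) := by
      rw [mul_comm (((3 : ℕ) : ℤ) ^ k * ((3 : ℕ) : ℤ)), ← mul_assoc, ← pow_add, Nat.sub_add_cancel hkk]
    rw [hsplit, mul_zsmul, hP']
    exact (mem_geomTorsion_iff W _ _).mp Q.2
  refine ⟨⟨P, hPmem⟩, Subtype.ext ?_⟩
  rw [hred]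
  exact hP'

include hkk hred in
/-- **A `ℤ/3^{k̃+1}`-basis of `E[3^{k̃}·3]` maps under `red` to a `ℤ/3^{k+1}`-basis of `E[3^k·3]`** (both free of
rank `2`, `red` onto and `ℤ/3^{k̃+1} → ℤ/3^{k+1}`-semilinear) — n1011-p11's `TorsionLevel.exists_bases_red` with
the gap `k̃ − k` arbitrary. [cite: SilvermanAEC2009, Cor. III.6.4 (b)] -/
theorem exists_bases_red_of_le [W.IsElliptic] :
    ∃ (n : ℕ) (b : Basis (Fin n) (ZMod (3 ^ (kt + 1))) (geomTorsion W (((3 : ℕ) : ℤ) ^ kt * ((3 : ℕ) : ℤ))))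
      (b' : Basis (Fin n) (ZMod (3 ^ (k + 1))) (geomTorsion W (((3 : ℕ) : ℤ) ^ k * ((3 : ℕ) : ℤ)))),
      ∀ i, red (b i) = b' i := by
  classical
  haveI : Fact (Nat.Prime 3) := ⟨Nat.prime_three⟩
  haveI : NeZero (3 ^ (kt + 1)) := ⟨pow_ne_zero _ (by norm_num)⟩
  haveI : Fact (1 < 3 ^ (kt + 1)) := ⟨Nat.one_lt_pow (Nat.succ_ne_zero _) (by norm_num)⟩
  haveI : Fact (1 < 3 ^ (k + 1)) := ⟨Nat.one_lt_pow (Nat.succ_ne_zero _) (by norm_num)⟩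
  let b₀ := Module.Free.chooseBasis (ZMod (3 ^ (kt + 1))) (geomTorsion W (((3 : ℕ) : ℤ) ^ kt * ((3 : ℕ) : ℤ)))
  let b := b₀.reindex (Fintype.equivFin _)
  have hcard : Fintype.card (Fin (Fintype.card (Module.Free.ChooseBasisIndex (ZMod (3 ^ (kt + 1)))
      (geomTorsion W (((3 : ℕ) : ℤ) ^ kt * ((3 : ℕ) : ℤ)))))) =
      Module.finrank (ZMod (3 ^ (k + 1))) (geomTorsion W (((3 : ℕ) : ℤ) ^ k * ((3 : ℕ) : ℤ))) := by
    rw [Fintype.card_fin, ← Module.finrank_eq_card_chooseBasisIndex,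
      TorsionLevel.finrank_geomTorsion_pow_mul W kt, TorsionLevel.finrank_geomTorsion_pow_mul W k]
  have hdvd : 3 ^ (k + 1) ∣ 3 ^ (kt + 1) := pow_dvd_pow 3 (by omega)
  have hspan : ⊤ ≤ Submodule.span (ZMod (3 ^ (k + 1))) (Set.range fun i => red (b i)) := by
    rintro x -
    obtain ⟨y, hy⟩ := red_surjective_of_le W hkk red hred x
    rw [← hy, ← b.sum_repr y, map_sum]
    refine Submodule.sum_mem _ fun i _ => ?_
    rw [map_zmod_smul_eq_castHom_smul hdvd red]
    exact Submodule.smul_mem _ _ (Submodule.subset_span ⟨i, rfl⟩)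
  exact ⟨_, b, basisOfTopLeSpanOfCardEqFinrank (fun i => red (b i)) hspan hcard, fun i => by
    rw [coe_basisOfTopLeSpanOfCardEqFinrank]⟩

include hkk hred in
/-- **Push-forward of Kolyvagin systems along `red : E[3^{k̃}·3] → E[3^k·3]`** (input (L-b) of the
liftability road). Data `D̃` (level `k̃`) and `D` (level `k`) with the same primes `P`, inside the class of
`τ` at level `3^{k̃+1}` and outside `S ⊇ ∞ ∪ {3} ∪ {bad}`, cyclotomic transverse conditions, THE canonical
comparison maps for one `η`: if `κ` is a Kolyvagin system for `(D̃, 𝓕_can^{(k̃)})` then `d ↦ red_*(κ_d)` is one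
for `(D, 𝓕_can^{(k)})`. Assembly of n1011-p15's `KSDevissage.isKolyvaginSystem_map` with: `𝓕_can` push-forward
(`Transport.localMap_red_tateLocalMap`), transverse push-forward (`localMap_mem_cyclotomicTransverse`),
comparison transport (`singularMap_localMap_eq_fs_of_hasCanonicalComparison` on matched bases).
[cite: Sakamoto2024, Def. 4.1 (p. 926) and Thm. 4.4 (1)] [cite: MazurRubin2004, Thm. 4.4.3 and Prop. 5.2.9]
[cite: Rubin2011, Def. 2.2.1 (p. 18) and §3.1 (p. 29)] -/
theorem isKolyvaginSystem_map_red_of_le [W.IsElliptic] {S : Finset (Place ℚ)}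
    (hS : ∀ w : InfinitePlace ℚ, (Sum.inl w : Place ℚ) ∈ S)
    (h3S : ∀ v : HeightOneSpectrum (𝓞 ℚ), ((3 : ℕ) : 𝓞 ℚ) ∈ v.asIdeal → (Sum.inr v : Place ℚ) ∈ S)
    (hbadS : ∀ v : HeightOneSpectrum (𝓞 ℚ), ¬ W.HasGoodReductionAt v → (Sum.inr v : Place ℚ) ∈ S)
    {Sset : Set (HeightOneSpectrum (𝓞 ℚ))} {τ : absoluteGaloisGroup ℚ}
    {Dt : KolyvaginDatum (W.torsionGaloisModule (((3 : ℕ) : ℤ) ^ kt * ((3 : ℕ) : ℤ)))}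
    {D : KolyvaginDatum (W.torsionGaloisModule (((3 : ℕ) : ℤ) ^ k * ((3 : ℕ) : ℤ)))}
    (hP : D.primes = Dt.primes)
    (hPc : Dt.primes ⊆ frobeniusClassPrimes
      (W.torsionGaloisModule (((3 : ℕ) : ℤ) ^ kt * ((3 : ℕ) : ℤ))) Sset τ (3 ^ (kt + 1)))
    (hPS : ∀ q ∈ Dt.primes, (Sum.inr q : Place ℚ) ∉ S)
    (hTt : Dt.transverse = cyclotomicTransverse _) (hT : D.transverse = cyclotomicTransverse _)
    {η : (q : HeightOneSpectrum (𝓞 ℚ)) → (ZMod (Ideal.absNorm q.asIdeal))ˣ}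
    (hDt : Dt.HasCanonicalComparison (3 ^ (kt + 1)) η) (hD : D.HasCanonicalComparison (3 ^ (k + 1)) η)
    {κ : Finset (HeightOneSpectrum (𝓞 ℚ)) →
      galoisCohomology (W.torsionGaloisModule (((3 : ℕ) : ℤ) ^ kt * ((3 : ℕ) : ℤ))) 1}
    (hκ : Dt.IsKolyvaginSystem (propagatedSelmerStructure W 3 kt) κ) :
    D.IsKolyvaginSystem (propagatedSelmerStructure W 3 k) fun d => galoisCohomology.map red 1 (κ d) := by
  classical
  haveI : Fact (Nat.Prime 3) := ⟨Nat.prime_three⟩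
  haveI : Fact (1 < 3) := ⟨by norm_num⟩
  haveI : Fact (1 < 3 ^ (k + 1)) := ⟨Nat.one_lt_pow (Nat.succ_ne_zero _) (by norm_num)⟩
  haveI : Fact (1 < 3 ^ (kt + 1)) := ⟨Nat.one_lt_pow (Nat.succ_ne_zero _) (by norm_num)⟩
  haveI : NeZero (3 ^ (kt + 1)) := ⟨pow_ne_zero _ (by norm_num)⟩
  haveI : NeZero (3 ^ (k + 1)) := ⟨pow_ne_zero _ (by norm_num)⟩
  haveI : Finite (geomTorsion W (((3 : ℕ) : ℤ) ^ kt * ((3 : ℕ) : ℤ))) := finite_geomTorsion_pow_mul W 3 kt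
  haveI : Finite (geomTorsion W (((3 : ℕ) : ℤ) ^ k * ((3 : ℕ) : ℤ))) := finite_geomTorsion_pow_mul W 3 k
  have hdvd : 3 ^ (k + 1) ∣ 3 ^ (kt + 1) := pow_dvd_pow 3 (by omega)
  -- the class of level `3^{k̃+1}` is inside the class of level `3^{k+1}` on `E[3^k·3]`
  have hker : ∀ u : absoluteGaloisGroup ℚ,
      (W.torsionGaloisModule (((3 : ℕ) : ℤ) ^ kt * ((3 : ℕ) : ℤ))) u = 1 →
        (W.torsionGaloisModule (((3 : ℕ) : ℤ) ^ k * ((3 : ℕ) : ℤ))) u = 1 := fun u hu =>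
    TorsionLevel.torsionGaloisModule_eq_one_of_dvd W (Transport.pow_mul_dvd_pow_mul hkk) u hu
  have hmono : ∀ q ∈ Dt.primes, q ∈ frobeniusClassPrimes
      (W.torsionGaloisModule (((3 : ℕ) : ℤ) ^ k * ((3 : ℕ) : ℤ))) Sset τ (3 ^ (k + 1)) := fun q hq =>
    S24Deep.frobeniusClassPrimes_mono _ _ hker Sset τ hdvd (hPc hq)
  -- `𝓕_can^{(k̃)}` is unramified at the primes
  have h𝓕t := propagatedSelmerStructure_isUnramifiedOutside W 3 kt S hS h3S hbadS
  -- matched bases for the comparison transport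
  obtain ⟨n, b, b', hb⟩ := exists_bases_red_of_le W hkk red hred
  refine isKolyvaginSystem_map red hP (fun q hq => (h𝓕t.2 q (hPS q hq)).le) ?_ ?_ ?_ hκ
  · -- `𝓕_can(E[3^{k̃}·3])` pushes forward into `𝓕_can(E[3^k·3])`: `red ∘ π_{k̃+1} = π_{k+1}` on `T_3E`
    intro v y hy
    obtain ⟨z, rfl⟩ := (mem_propagatedSelmerStructure_iff W 3 kt v y).mp hy
    obtain ⟨φ, rfl⟩ := oneCocycleClass_surjective (tateLocalRep W 3 v).toTopRep z
    exact (mem_propagatedSelmerStructure_iff W 3 k v _).mpr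
      ⟨_, (Transport.localMap_red_tateLocalMap W hkk red hred v φ).symm⟩
  · -- transverse push-forward
    intro q hq y hy
    rw [hTt] at hy
    rw [hT]
    exact localMap_mem_cyclotomicTransverse red q hy
  · -- comparison transport (n1011-p15 F-B1b) on the matched bases
    intro q hq y hy w hw
    exact singularMap_localMap_eq_fs_of_hasCanonicalComparison hdvd red b b' hb hDt hD hq
      (hP.symm ▸ hq) (hPc hq).2.2.1 (hmono q hq).2.2.1 hy w hw

end Summit.BirchSwinnertonDyer.BirchSwinnertonDyer.Theorems.KimAtThreeStubOfLiftable

end
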